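import Summits.AtomisticToContinuum.HydrodynamicLimit.Theorems.CollisionIsometryCLTCollisionalTransferLocalityWeightedVelocityAverages
import Summits.AtomisticToContinuum.HydrodynamicLimit.Theorems.JParityClosureOddContactSymmetryGibbsInvariance
import Summits.AtomisticToContinuum.HydrodynamicLimit.Theorems.JParityClosureEvenStressEnskogVelocityFactorisation
import Summits.AtomisticToContinuum.HydrodynamicLimit.Theorems.MourreKoopmanChargesIdealGasNoDecay
import Summits.AtomisticToContinuum.HydrodynamicLimit.Theorems.MourreKoopmanChargesStressStrongMixingTorusStressRawEqCov
import Literature.MathematicalPhysics.KineticTheory.HardSphereTwoTimePressure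
import HarnessLib

/-!
# `OneBodyCompleteness` · line `registered`, stub 5a `stub_torusMoments`:
# two-time moments of the one-body empirical field under the canonical law on `𝕋³`

Support file for the crux item stmt-AtomisticToContinuum-9583 (`OneBodyCompleteness`, route
`MourreKoopmanCharges` of `AtomisticToContinuum/HydrodynamicLimit`), proving the registered stub
`stub_torusMoments` of the skeleton `Cruxes/OneBodyCompleteness/Lines/birth.lean`.

Setting: `N + 1` hard spheres of diameter `hsDiameter σ N` on `𝕋³` under the canonical ("rung-0",
constant-profile) law `G = localGibbsLaw σ 1 0 θ N Φ` (`0 < σ < 1/2`, `0 < θ`), a continuous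
polynomially bounded velocity profile `h` with `∫ h M_θ = 0`, a continuous `χ` on `𝕋³`, and the
one-body empirical field `A(z) = ∫ χ(y.1) h(y.2) d(empiricalMeasure z) = (N+1)⁻¹ Σᵢ χ(xᵢ) h(vᵢ)`.

* (i) `cov[A ∘ Φ_t, A; G] = ∫ (A ∘ Φ_t) · A dG`: the velocities are i.i.d. `N(0, θ id)` and
  independent of the positions under `G` (`integral_pos_mul_vel_localGibbsLaw_const`), so each summand
  `E_G[χ(xᵢ) h(vᵢ)] = E_pos[χ(xᵢ)] · ∫ h dN(0, θ id) = 0`, whence `E_G[A] = 0`; by stationarity of `G`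
  under every `Φ_t` (`integral_comp_flow_localGibbsLaw_const`) also `E_G[A ∘ Φ_t] = 0`; and Mathlib's
  covariance is literally `∫ (X - E X)(Y - E Y)`
  (`MourreKoopmanChargesStressStrongMixing.covariance_eq_integral_mul_of_integral_eq_zero`).
* (ii) `|∫ (A ∘ Φ_t) · A dG| ≤ ∫ (A ∘ Φ_0) · A dG`: `A ∈ L²(G)` (each `vᵢ` has law `N(0, θ id)`,
  `h ∈ L²(N(0, θ id))` by polynomial growth, `χ` bounded), `A ∘ Φ_t ∈ L²(G)` with the same second
  moment (invariance), `|xy| ≤ (x² + y²)/2`, and `Φ_0 = id` `G`-a.e. (`ae_mem_good_localGibbsLaw`).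

References: H. Spohn, *Large Scale Dynamics of Interacting Particles* (1991), Part I §2.3 (local
equilibrium states, product structure); GST 2013 Prop. 4.1.1 (Liouville). Folklore otherwise.
-/

noncomputable section

namespace Summit.AtomisticToContinuum.HydrodynamicLimit.Theorems.MourreKoopmanChargesOneBodyCompleteness

open MeasureTheory ProbabilityTheory Filter Topology Set
open scoped ENNReal InnerProductSpace BigOperators
open Literature.Analysis.FluidPDE Literature.MathematicalPhysics.KineticTheory
open Summit.AtomisticToContinuum.HydrodynamicLimit.Theorems.MourreKoopmanChargesIdealGasNoDecay

/-! ### Abstract piece: domination of a two-time moment under an invariant map -/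

/-- **Domination of a two-time moment by the equal-time one.** If `T` preserves `μ` and
`X ∈ L²(μ)` is measurable, then `|∫ X(T z) X(z) dμ| ≤ ∫ X² dμ` (`|xy| ≤ (x² + y²)/2` and
`∫ (X ∘ T)² dμ = ∫ X² dμ`). [folklore] -/
theorem abs_integral_comp_mul_le {α : Type*} [MeasurableSpace α] {μ : Measure α} {T : α → α}
    (hT : MeasurePreserving T μ μ) {X : α → ℝ} (hX : Measurable X) (hX2 : MemLp X 2 μ) :
    |∫ z, X (T z) * X z ∂μ| ≤ ∫ z, X z ^ 2 ∂μ := by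
  have hXT : MemLp (fun z => X (T z)) 2 μ := hX2.comp_measurePreserving hT
  have hsq : ∫ z, X (T z) ^ 2 ∂μ = ∫ z, X z ^ 2 ∂μ := by
    have h := integral_map_of_stronglyMeasurable (μ := μ) hT.measurable
      ((hX.pow_const 2).stronglyMeasurable : StronglyMeasurable fun z => X z ^ 2)
    rw [hT.map_eq] at h
    exact h.symm
  have hI : Integrable (fun z => (X (T z) ^ 2 + X z ^ 2) / 2) μ :=
    (hXT.integrable_sq.add hX2.integrable_sq).div_const 2
  calc |∫ z, X (T z) * X z ∂μ| ≤ ∫ z, |X (T z) * X z| ∂μ := abs_integral_le_integral_abs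
    _ ≤ ∫ z, (X (T z) ^ 2 + X z ^ 2) / 2 ∂μ :=
        integral_mono_of_nonneg (ae_of_all _ fun z => abs_nonneg _) hI
          (ae_of_all _ fun z => by
            show |X (T z) * X z| ≤ (X (T z) ^ 2 + X z ^ 2) / 2
            rw [abs_mul]
            nlinarith [two_mul_le_add_sq |X (T z)| |X z|, sq_abs (X (T z)), sq_abs (X z)])
    _ = ((∫ z, X (T z) ^ 2 ∂μ) + ∫ z, X z ^ 2 ∂μ) / 2 := by
        rw [integral_div, integral_add hXT.integrable_sq hX2.integrable_sq]
    _ = ∫ z, X z ^ 2 ∂μ := by rw [hsq]; ring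

/-! ### The one-body empirical field -/

/-- The one-body empirical field as a finite sum:
`∫ χ(y.1) h(y.2) d(empiricalMeasure z) = n⁻¹ Σᵢ χ(xᵢ) h(vᵢ)` (`integral_empiricalMeasure`). [folklore] -/
theorem oneBodyField_eq_sum {n : ℕ} (χ : T3 → ℝ) (h : V3 → ℝ) (z : Config n (Fin 3) T3) :
    ∫ y, χ y.1 * h y.2 ∂(empiricalMeasure z) = (n : ℝ)⁻¹ * ∑ i, χ (z i).1 * h (z i).2 :=
  integral_empiricalMeasure z _

/-- The one-body empirical field of continuous `χ, h` is a measurable function of the configuration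
(a finite sum of continuous functions of the coordinates). [folklore] -/
theorem measurable_oneBodyField {n : ℕ} {χ : T3 → ℝ} (hχ : Continuous χ) {h : V3 → ℝ}
    (hh : Continuous h) :
    Measurable fun z : Config n (Fin 3) T3 => ∫ y, χ y.1 * h y.2 ∂(empiricalMeasure z) := by
  have hF : Continuous fun y : T3 × V3 => χ y.1 * h y.2 := by fun_prop
  have e : (fun z : Config n (Fin 3) T3 => ∫ y, χ y.1 * h y.2 ∂(empiricalMeasure z)) =
      fun z => (n : ℝ)⁻¹ * ∑ i, χ (z i).1 * h (z i).2 :=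
    funext fun z => oneBodyField_eq_sum χ h z
  rw [e]
  exact measurable_const.mul
    (Finset.measurable_sum _ fun i _ => hF.measurable.comp (measurable_pi_apply i))

/-! ### Statics of the canonical law `G = localGibbsLaw σ 1 0 θ N Φ` -/

/-- **Each velocity is `N(0, θ id)`-distributed under the canonical law** (single-flow form of
`HemisphereAffineSlaving.measurePreserving_vel_localGibbsLaw_const`): for `θ > 0`, `σ ≤ 1/2`, every
flow and every label `i`, `z ↦ vᵢ` pushes `localGibbsLaw σ 1 0 θ N Φ` forward to `gaussMeasure 0 θ`
(rung-0 product structure, the configurational factor being a probability measure). [folklore] -/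
theorem measurePreserving_vel_localGibbsLaw_one {σ θ : ℝ} (hθ : 0 < θ) (hσ : σ ≤ 1 / 2) (N : ℕ)
    (Φ : HardSphereFlow (Torus.geometry (Fin 3)) (hsDiameter σ N) (N + 1)) (i : Fin (N + 1)) :
    MeasurePreserving (fun z : Config (N + 1) (Fin 3) T3 => (z i).2)
      (localGibbsLaw σ (fun _ => 1) (fun _ => 0) (fun _ => θ) N Φ) (gaussMeasure (0 : V3) θ) := by
  -- adapted from HemisphereAffineSlaving.measurePreserving_vel_localGibbsLaw_const (family form)
  haveI := isProbabilityMeasure_posGibbsMeasure (a₀ := fun _ : T3 => (1 : ℝ)) continuous_const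
    (fun _ => one_pos) hσ N
  refine ⟨(measurable_pi_apply i).snd, ?_⟩
  rw [localGibbsLaw_eq, localGibbsMeasure_rung0_eq_map σ zero_le_one hθ (0 : V3) N,
    Measure.map_map (measurable_pi_apply i).snd measurable_zipConfig]
  exact (HemisphereAffineSlaving.measurePreserving_snd_eval _ (gaussMeasure (0 : V3) θ) i).map_eq

/-- A continuous velocity profile of polynomial growth is in `L²(N(0, θ id))`. [folklore] -/
theorem memLp_two_gaussMeasure_of_poly_growth (θ : ℝ) {h : V3 → ℝ} (hh : Continuous h) {C : ℝ}
    {k : ℕ} (hCk : ∀ v, |h v| ≤ C * (1 + ‖v‖) ^ k) : MemLp h 2 (gaussMeasure (0 : V3) θ) :=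
  (memLp_two_iff_integrable_sq hh.aestronglyMeasurable).2
    (integrable_of_poly_growth _ (hh.pow 2).aestronglyMeasurable (sq_growth hCk))

/-- Each summand `z ↦ χ(xᵢ) h(vᵢ)` of the one-body field is in `L²(G)` under the canonical law, for
`χ` measurable bounded and `h ∈ L²(N(0, θ id))` (dominated by `C_χ |h(vᵢ)|`, `vᵢ` having law
`N(0, θ id)`). [folklore] -/
theorem memLp_two_summand_localGibbsLaw_one {σ θ : ℝ} (hθ : 0 < θ) (hσ : σ ≤ 1 / 2) (N : ℕ)
    (Φ : HardSphereFlow (Torus.geometry (Fin 3)) (hsDiameter σ N) (N + 1)) {χ : T3 → ℝ}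
    (hχ : Measurable χ) {Cχ : ℝ} (hCχ : ∀ x, |χ x| ≤ Cχ) {h : V3 → ℝ}
    (hh2 : MemLp h 2 (gaussMeasure (0 : V3) θ)) (i : Fin (N + 1)) :
    MemLp (fun z : Config (N + 1) (Fin 3) T3 => χ (z i).1 * h (z i).2) 2
      (localGibbsLaw σ (fun _ => 1) (fun _ => 0) (fun _ => θ) N Φ) := by
  -- adapted from HemisphereAffineSlaving.memLp_two_weight_mul_vel_localGibbsLaw_const (family form)
  have hqi : MemLp (fun z : Config (N + 1) (Fin 3) T3 => h (z i).2) 2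
      (localGibbsLaw σ (fun _ => 1) (fun _ => 0) (fun _ => θ) N Φ) :=
    hh2.comp_measurePreserving (measurePreserving_vel_localGibbsLaw_one hθ hσ N Φ i)
  have hfi : AEStronglyMeasurable (fun z : Config (N + 1) (Fin 3) T3 => χ (z i).1)
      (localGibbsLaw σ (fun _ => 1) (fun _ => 0) (fun _ => θ) N Φ) :=
    (hχ.comp (measurable_pi_apply i).fst).aestronglyMeasurable
  refine (hqi.const_mul Cχ).of_le (hfi.mul hqi.aestronglyMeasurable) (ae_of_all _ fun z => ?_)
  rw [norm_mul, norm_mul, Real.norm_eq_abs, Real.norm_eq_abs Cχ]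
  exact mul_le_mul_of_nonneg_right ((hCχ _).trans (le_abs_self Cχ)) (norm_nonneg _)

/-- **The one-body empirical field is in `L²(G)`** under the canonical law, for continuous `χ` and a
continuous velocity profile `h` of polynomial growth. [folklore] -/
theorem memLp_two_oneBodyField_localGibbsLaw_one {σ θ : ℝ} (hθ : 0 < θ) (hσ : σ ≤ 1 / 2) (N : ℕ)
    (Φ : HardSphereFlow (Torus.geometry (Fin 3)) (hsDiameter σ N) (N + 1)) {χ : T3 → ℝ}
    (hχ : Continuous χ) {h : V3 → ℝ} (hh : Continuous h) {C : ℝ} {k : ℕ}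
    (hCk : ∀ v, |h v| ≤ C * (1 + ‖v‖) ^ k) :
    MemLp (fun z : Config (N + 1) (Fin 3) T3 => ∫ y, χ y.1 * h y.2 ∂(empiricalMeasure z)) 2
      (localGibbsLaw σ (fun _ => 1) (fun _ => 0) (fun _ => θ) N Φ) := by
  obtain ⟨Cχ, _, hCχ⟩ := exists_bound_of_continuous hχ
  have e : (fun z : Config (N + 1) (Fin 3) T3 => ∫ y, χ y.1 * h y.2 ∂(empiricalMeasure z)) =
      fun z => ((N + 1 : ℕ) : ℝ)⁻¹ * ∑ i, χ (z i).1 * h (z i).2 :=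
    funext fun z => oneBodyField_eq_sum χ h z
  rw [e]
  exact (memLp_finsetSum
    (f := fun (i : Fin (N + 1)) (z : Config (N + 1) (Fin 3) T3) => χ (z i).1 * h (z i).2)
    Finset.univ fun i _ => memLp_two_summand_localGibbsLaw_one hθ hσ N Φ hχ.measurable hCχ
      (memLp_two_gaussMeasure_of_poly_growth θ hh hCk) i).const_mul _

/-- **Each summand is centred**: `E_G[χ(xᵢ) h(vᵢ)] = E_pos[χ(xᵢ)] · ∫ h dN(0, θ id) = 0` when
`∫ h M_θ = 0` (velocity factorisation at rung 0, `integral_pos_mul_vel_localGibbsLaw_const`, and the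
one-coordinate marginal of the product Gaussian). [folklore] -/
theorem integral_summand_localGibbsLaw_one (σ : ℝ) {θ : ℝ} (hθ : 0 < θ) (N : ℕ)
    (Φ : HardSphereFlow (Torus.geometry (Fin 3)) (hsDiameter σ N) (N + 1)) (χ : T3 → ℝ)
    {h : V3 → ℝ} (hh : Measurable h) (h1 : ∫ v, h v * localMaxwellian 1 θ (0 : V3) v = 0)
    (i : Fin (N + 1)) :
    ∫ z, χ (z i).1 * h (z i).2 ∂(localGibbsLaw σ (fun _ => 1) (fun _ => 0) (fun _ => θ) N Φ) = 0 := by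
  have hv : ∫ v, h (v i) ∂(Measure.pi fun _ : Fin (N + 1) => gaussMeasure (0 : V3) θ) = 0 := by
    rw [integral_eval_pi (gaussMeasure (0 : V3) θ) h hh i, integral_gaussMeasure_eq_integral_mul hθ h,
      h1]
  have hfac := EvenStressEnskog.integral_pos_mul_vel_localGibbsLaw_const σ zero_le_one hθ (0 : V3) N Φ
    (fun x => χ (x i)) (fun v => h (v i))
  rw [hv, mul_zero] at hfac
  exact hfac

/-- **The one-body empirical field is centred under the canonical law**: `E_G[A] = 0` for
continuous `χ`, continuous polynomially bounded `h` with `∫ h M_θ = 0`, `θ > 0`, `σ ≤ 1/2`.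
[folklore] -/
theorem integral_oneBodyField_localGibbsLaw_one {σ θ : ℝ} (hθ : 0 < θ) (hσ : σ ≤ 1 / 2) (N : ℕ)
    (Φ : HardSphereFlow (Torus.geometry (Fin 3)) (hsDiameter σ N) (N + 1)) {χ : T3 → ℝ}
    (hχ : Continuous χ) {h : V3 → ℝ} (hh : Continuous h) {C : ℝ} {k : ℕ}
    (hCk : ∀ v, |h v| ≤ C * (1 + ‖v‖) ^ k) (h1 : ∫ v, h v * localMaxwellian 1 θ (0 : V3) v = 0) :
    ∫ z, (∫ y, χ y.1 * h y.2 ∂(empiricalMeasure z))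
      ∂(localGibbsLaw σ (fun _ => 1) (fun _ => 0) (fun _ => θ) N Φ) = 0 := by
  haveI := isProbabilityMeasure_localGibbsLaw_const (σ := σ) hθ hσ (0 : V3) N Φ
  obtain ⟨Cχ, _, hCχ⟩ := exists_bound_of_continuous hχ
  have hint : ∀ i : Fin (N + 1), Integrable (fun z : Config (N + 1) (Fin 3) T3 => χ (z i).1 * h (z i).2)
      (localGibbsLaw σ (fun _ => 1) (fun _ => 0) (fun _ => θ) N Φ) := fun i =>
    (memLp_two_summand_localGibbsLaw_one hθ hσ N Φ hχ.measurable hCχ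
      (memLp_two_gaussMeasure_of_poly_growth θ hh hCk) i).integrable one_le_two
  simp_rw [oneBodyField_eq_sum χ h]
  rw [integral_const_mul, integral_finsetSum _ fun i _ => hint i,
    Finset.sum_eq_zero fun i _ => integral_summand_localGibbsLaw_one σ hθ N Φ χ hh.measurable h1 i,
    mul_zero]

/-- **Stationarity of the mean**: `E_G[A ∘ Φ_t] = 0` as well (`integral_comp_flow_localGibbsLaw_const`).
[folklore] -/
theorem integral_oneBodyField_flow_localGibbsLaw_one {σ θ : ℝ} (hθ : 0 < θ) (hσ : σ ≤ 1 / 2) (N : ℕ)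
    (Φ : HardSphereFlow (Torus.geometry (Fin 3)) (hsDiameter σ N) (N + 1)) {χ : T3 → ℝ}
    (hχ : Continuous χ) {h : V3 → ℝ} (hh : Continuous h) {C : ℝ} {k : ℕ}
    (hCk : ∀ v, |h v| ≤ C * (1 + ‖v‖) ^ k) (h1 : ∫ v, h v * localMaxwellian 1 θ (0 : V3) v = 0)
    (t : ℝ) :
    ∫ z, (∫ y, χ y.1 * h y.2 ∂(empiricalMeasure (Φ.flow t z)))
      ∂(localGibbsLaw σ (fun _ => 1) (fun _ => 0) (fun _ => θ) N Φ) = 0 :=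
  (integral_comp_flow_localGibbsLaw_const σ 1 θ 0 N Φ t
      (measurable_oneBodyField (n := N + 1) hχ hh).aestronglyMeasurable).trans
    (integral_oneBodyField_localGibbsLaw_one hθ hσ N Φ hχ hh hCk h1)

/-! ### The registered stub -/

/-- **STUB 5a `stub_torusMoments`** of the line `registered` of crux stmt-AtomisticToContinuum-9583
(`OneBodyCompleteness`): under the canonical law `G = localGibbsLaw σ 1 0 θ N Φ` (`0 < σ < 1/2`,
`0 < θ`), for the one-body empirical field `A(z) = ∫ χ(y.1) h(y.2) d(empiricalMeasure z)` of a
continuous polynomially bounded `h` with `∫ h M_θ = 0` and a continuous `χ`, (i) the two-time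
covariance `cov[A ∘ Φ_t, A; G]` IS the raw two-time moment (both means vanish: velocity
factorisation and stationarity), and (ii) every two-time moment is dominated by the equal-time one,
`|E_G[(A ∘ Φ_t) A]| ≤ E_G[(A ∘ Φ_0) A]` (`A, A ∘ Φ_t ∈ L²(G)` with equal second moments by
invariance, `|xy| ≤ (x² + y²)/2`, and `Φ_0 = id` `G`-a.e.). [folklore] -/
theorem stub_torusMoments :
    ∀ σ : ℝ, 0 < σ → σ < 1 / 2 → ∀ θ : ℝ, 0 < θ →
      ∀ h : Literature.MathematicalPhysics.KineticTheory.V3 → ℝ, Continuous h →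
        (∃ (C : ℝ) (k : ℕ), ∀ v, |h v| ≤ C * (1 + ‖v‖) ^ k) →
        (∫ v, h v * Literature.Analysis.FluidPDE.localMaxwellian 1 θ
            (0 : Literature.MathematicalPhysics.KineticTheory.V3) v = 0) →
        ∀ (N : ℕ) (Φ : Literature.Analysis.FluidPDE.HardSphereFlow
            (Literature.Analysis.FluidPDE.Torus.geometry (Fin 3))
            (Literature.MathematicalPhysics.KineticTheory.hsDiameter σ N) (N + 1))
          (χ : Literature.MathematicalPhysics.KineticTheory.T3 → ℝ), Continuous χ → ∀ t : ℝ,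
          cov[fun z => ∫ y, χ y.1 * h y.2 ∂(Literature.Analysis.FluidPDE.empiricalMeasure
                (Φ.flow t z)),
              fun z => ∫ y, χ y.1 * h y.2 ∂(Literature.Analysis.FluidPDE.empiricalMeasure z);
            Literature.MathematicalPhysics.KineticTheory.localGibbsLaw σ (fun _ => 1) (fun _ => 0)
              (fun _ => θ) N Φ] =
            ∫ z, (∫ y, χ y.1 * h y.2 ∂(Literature.Analysis.FluidPDE.empiricalMeasure (Φ.flow t z))) *
              (∫ y, χ y.1 * h y.2 ∂(Literature.Analysis.FluidPDE.empiricalMeasure z))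
              ∂(Literature.MathematicalPhysics.KineticTheory.localGibbsLaw σ (fun _ => 1) (fun _ => 0)
                (fun _ => θ) N Φ) ∧
          |∫ z, (∫ y, χ y.1 * h y.2 ∂(Literature.Analysis.FluidPDE.empiricalMeasure (Φ.flow t z))) *
              (∫ y, χ y.1 * h y.2 ∂(Literature.Analysis.FluidPDE.empiricalMeasure z))
              ∂(Literature.MathematicalPhysics.KineticTheory.localGibbsLaw σ (fun _ => 1) (fun _ => 0)
                (fun _ => θ) N Φ)| ≤
            ∫ z, (∫ y, χ y.1 * h y.2 ∂(Literature.Analysis.FluidPDE.empiricalMeasure (Φ.flow 0 z))) *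
              (∫ y, χ y.1 * h y.2 ∂(Literature.Analysis.FluidPDE.empiricalMeasure z))
              ∂(Literature.MathematicalPhysics.KineticTheory.localGibbsLaw σ (fun _ => 1) (fun _ => 0)
                (fun _ => θ) N Φ) := by
  intro σ _hσ hσ2 θ hθ h hh hpoly h1 N Φ χ hχ t
  obtain ⟨C, k, hCk⟩ := hpoly
  have hA0 := integral_oneBodyField_localGibbsLaw_one hθ hσ2.le N Φ hχ hh hCk h1
  have hAt0 := integral_oneBodyField_flow_localGibbsLaw_one hθ hσ2.le N Φ hχ hh hCk h1 t
  refine ⟨MourreKoopmanChargesStressStrongMixing.covariance_eq_integral_mul_of_integral_eq_zero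
    hAt0 hA0, ?_⟩
  have hdom := abs_integral_comp_mul_le (measurePreserving_flow_localGibbsLaw_const σ 1 θ 0 N Φ t)
    (measurable_oneBodyField (n := N + 1) hχ hh)
    (memLp_two_oneBodyField_localGibbsLaw_one hθ hσ2.le N Φ hχ hh hCk)
  have h0 : ∫ z, (∫ y, χ y.1 * h y.2 ∂(empiricalMeasure (Φ.flow 0 z))) *
        (∫ y, χ y.1 * h y.2 ∂(empiricalMeasure z))
        ∂(localGibbsLaw σ (fun _ => 1) (fun _ => 0) (fun _ => θ) N Φ) =
      ∫ z, (∫ y, χ y.1 * h y.2 ∂(empiricalMeasure z)) ^ 2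
        ∂(localGibbsLaw σ (fun _ => 1) (fun _ => 0) (fun _ => θ) N Φ) := by
    refine integral_congr_ae ?_
    filter_upwards [ae_mem_good_localGibbsLaw σ (fun _ => 1) (fun _ => 0) (fun _ => θ) N Φ]
      with z hz
    rw [Φ.flow_zero z hz, sq]
  rw [h0]
  exact hdom

end Summit.AtomisticToContinuum.HydrodynamicLimit.Theorems.MourreKoopmanChargesOneBodyCompleteness

end
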